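import Summits.QuantumFields.QCD.Theorems.QuarksAsStableActionStableActionBridgeFockLiftPosDef
import Summits.QuantumFields.QCD.Theorems.QuarksAsStableActionStableActionBridgeStubScalarKernelProps
import HarnessLib

/-!
# Stub `stub_supertrace_undress_insert` of line `pin-the-infimum` (crux `RobustYangMillsHandover`, 8892)

E2, layer β2 of the fermionic-insertion bricks in Lüscher's transfer-matrix representation of the
QCD torus functional: **cyclic undressing of the supertrace with arbitrary Fock insertions**.

In Lüscher's transfer form of the Wilson determinant each one-step matrix is dressed by the
temporal transporters, `N_i = S_{i−1} Y_i S_i⁻¹` at the one-particle level, and the second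
quantisation `Γ = fockLift` is multiplicative, so `Γ(N_i) = Γ(S_{i−1}) Γ(Y_i) Γ(S_i⁻¹)` with
`Γ(S_i) Γ(S_i⁻¹) = Γ(S_i⁻¹) Γ(S_i) = 1`.  With arbitrary Fock-level insertions `Q_i` placed before
each dressed factor and `Xf_i` standing for `Γ(Y_i)` (slices labelled by `ZMod T`, the time-ordered
product being `((List.range T).map …).prod`), the cyclic supertrace `STr X = Σ_s (−1)^{#s} X_{ss}`
undresses:

  `STr ∏_{i<T} Q_i Γ(S_{i−1}) Xf_i Γ(S_i⁻¹) = STr ∏_{i<T} Γ(S_{i−1}⁻¹) Q_i Γ(S_{i−1}) Xf_i`.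

## Proof

* `StubSupertraceUndressInsert.prod_range_dressed` — the dressed product telescopes, for every `k`,
  `∏_{i<k} Q_i Γ(S_{i−1}) Xf_i Γ(S_i⁻¹) = Γ(S_{0−1}) · (∏_{i<k} Γ(S_{i−1}⁻¹) Q_i Γ(S_{i−1}) Xf_i) · Γ(S_{k−1}⁻¹)`
  (induction on `k`; the base case is `Γ(S_{−1}) Γ(S_{−1}⁻¹) = 1`, the step is associativity and
  `((k+1 : ℕ) : ZMod T) − 1 = k`);
* for `k = T` the seam index is `(T : ZMod T) − 1 = 0 − 1`, so the product is conjugated by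
  `Γ(S_{−1})`;
* `StubSupertraceUndressInsert.supertrace_eq_trace` — `STr X = Tr (Π X)` with the fermion parity
  `Π = diag((−1)^{#s})`, and `Π` commutes with every `Γ(X)` (`parity_comm_fockLift`, number
  conservation), so the weighted trace is invariant under conjugation by `Γ(S_{−1})`
  (`StubSupertraceUndressInsert.trace_weight_conj`, from `Matrix.trace_mul_comm`).

No parity assumption on the insertions `Q_i`, `Xf_i` is needed, and `NeZero T` is not used.
Pure theorem file (no definitions); Mathlib matrix algebra plus the tree's `fockLift` calculus
(`FockLiftPosDef.fockLift_mul_inv`, `fockLift_inv_mul`, `StubScalarKernelProps.parity_comm_fockLift`).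

References: M. Lüscher, *Construction of a selfadjoint, strictly positive transfer matrix for
Euclidean lattice gauge theories*, Comm. Math. Phys. 54 (1977) 283–292; I. Montvay, G. Münster,
*Quantum Fields on a Lattice* (CUP 1994), §4 (transfer matrix for Wilson fermions).
-/

namespace Summit.QuantumFields.QCD.Cruxes.RobustYangMillsHandover.PinTheInfimum

open Literature.MathematicalPhysics.QuantumFieldTheory
open Summit.QuantumFields.QCD.Cruxes.StableActionBridge.Sketch.FockLiftPosDef
open Summit.QuantumFields.QCD.Cruxes.StableActionBridge.TwistedTraceTransfer.StubScalarKernelProps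

namespace StubSupertraceUndressInsert

section Trace

variable {F : Type*} [Fintype F]

/-- **Cyclicity of a weighted trace**: if the weight `P` commutes with `B`, then
`Tr (P · A B) = Tr (P · B A)`. [folklore] -/
theorem trace_weight_mul_comm {P A B : Matrix F F ℂ} (h : P * B = B * P) :
    (P * (A * B)).trace = (P * (B * A)).trace := by
  rw [← Matrix.mul_assoc, Matrix.trace_mul_comm, ← Matrix.mul_assoc, ← h, Matrix.mul_assoc]

/-- **Conjugation invariance of a weighted trace**: if the weight `P` commutes with `C` and
`C B = 1`, then `Tr (P · B A C) = Tr (P · A)`. [folklore] -/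
theorem trace_weight_conj [DecidableEq F] {P A B C : Matrix F F ℂ} (h : P * C = C * P)
    (hCB : C * B = 1) :
    (P * (B * A * C)).trace = (P * A).trace := by
  rw [trace_weight_mul_comm h, ← Matrix.mul_assoc C B A, hCB, Matrix.one_mul]

end Trace

variable {ι : Type*} [LinearOrder ι] [Fintype ι]

/-- **The supertrace is the parity-weighted trace**: `Σ_s (−1)^{#s} X_{ss} = Tr (diag((−1)^{#s}) · X)`.
[folklore] -/
theorem supertrace_eq_trace (X : Matrix (Finset ι) (Finset ι) ℂ) :
    ∑ s : Finset ι, (-1 : ℂ) ^ s.card * X s s =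
      (Matrix.diagonal (fun s : Finset ι => (-1 : ℂ) ^ s.card) * X).trace := by
  rw [Matrix.trace]
  simp only [Matrix.diag_apply, Matrix.diagonal_mul]

/-- **Telescoping of the dressed product with insertions.**  For every `k`,
`∏_{i<k} Q_i Γ(S_{i−1}) Xf_i Γ(S_i⁻¹) = Γ(S_{0−1}) · (∏_{i<k} Γ(S_{i−1}⁻¹) Q_i Γ(S_{i−1}) Xf_i) · Γ(S_{k−1}⁻¹)`
(indices `i : ℕ` read in `ZMod T`): the base case is `Γ(S_{−1}) Γ(S_{−1}⁻¹) = 1`, and the step is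
associativity together with `((k + 1 : ℕ) : ZMod T) − 1 = k`. [folklore] -/
theorem prod_range_dressed (T : ℕ) (S : ZMod T → Matrix ι ι ℂ)
    (Q Xf : ZMod T → Matrix (Finset ι) (Finset ι) ℂ) (hS : ∀ t, IsUnit (S t).det) (k : ℕ) :
    ((List.range k).map fun i : ℕ =>
        Q (i : ZMod T) * fockLift (S ((i : ZMod T) - 1)) * Xf (i : ZMod T) *
          fockLift ((S (i : ZMod T))⁻¹)).prod =
      fockLift (S (((0 : ℕ) : ZMod T) - 1)) *
        ((List.range k).map fun i : ℕ =>
          fockLift ((S ((i : ZMod T) - 1))⁻¹) * Q (i : ZMod T) * fockLift (S ((i : ZMod T) - 1)) *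
            Xf (i : ZMod T)).prod *
        fockLift ((S ((k : ZMod T) - 1))⁻¹) := by
  induction k with
  | zero =>
    rw [List.range_zero, List.map_nil, List.map_nil, List.prod_nil, Matrix.mul_one,
      fockLift_mul_inv (hS _)]
  | succ k ih =>
    rw [List.prod_range_succ, ih, List.prod_range_succ]
    have hk : (((k + 1 : ℕ) : ZMod T) - 1) = (k : ZMod T) := by
      push_cast
      ring
    rw [hk]
    simp only [Matrix.mul_assoc]

/-- **Cyclic undressing of the supertrace with insertions** (universe-polymorphic form of the
registered stub, valid for every `T`): for invertible one-particle transporters `S_t`,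
`STr ∏_{i<T} Q_i Γ(S_{i−1}) Xf_i Γ(S_i⁻¹) = STr ∏_{i<T} Γ(S_{i−1}⁻¹) Q_i Γ(S_{i−1}) Xf_i`:
telescope (`prod_range_dressed` at `k = T`, seam index `(T : ZMod T) − 1 = 0 − 1`), then move
`Γ(S_{−1}⁻¹)` from the far right to the far left under the parity-weighted trace (the parity
commutes with every `Γ`, `parity_comm_fockLift`) and cancel `Γ(S_{−1}⁻¹) Γ(S_{−1}) = 1`.
[cite: Luscher1977, pp. 283–292] -/
theorem supertrace_undress_insert (T : ℕ) (S : ZMod T → Matrix ι ι ℂ)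
    (Q Xf : ZMod T → Matrix (Finset ι) (Finset ι) ℂ) (hS : ∀ t, IsUnit (S t).det) :
    ∑ s : Finset ι, (-1 : ℂ) ^ s.card *
        (((List.range T).map fun i : ℕ =>
          Q (i : ZMod T) * fockLift (S ((i : ZMod T) - 1)) * Xf (i : ZMod T) *
            fockLift ((S (i : ZMod T))⁻¹)).prod) s s =
      ∑ s : Finset ι, (-1 : ℂ) ^ s.card *
        (((List.range T).map fun i : ℕ =>
          fockLift ((S ((i : ZMod T) - 1))⁻¹) * Q (i : ZMod T) * fockLift (S ((i : ZMod T) - 1)) *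
            Xf (i : ZMod T)).prod) s s := by
  have h0 : ((T : ℕ) : ZMod T) - 1 = ((0 : ℕ) : ZMod T) - 1 := by
    rw [ZMod.natCast_self, Nat.cast_zero]
  rw [supertrace_eq_trace, supertrace_eq_trace, prod_range_dressed T S Q Xf hS T, h0,
    trace_weight_conj (parity_comm_fockLift _) (fockLift_inv_mul (hS _))]

end StubSupertraceUndressInsert

/-- **E2 β2: cyclic undressing of the supertrace with arbitrary Fock insertions.**  In Lüscher's
transfer form of the Wilson determinant the one-step matrices are dressed by temporal transporters,
`Γ(N_i) = Γ(S_{i−1}) Γ(Y_i) Γ(S_i)⁻¹` (`Γ = fockLift` is multiplicative); with arbitrary Fock-level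
insertions `Q_i` before each dressed factor and `Xf_i` in place of `Γ(Y_i)`, for invertible `S_t`
(`t : ZMod T`),
`Σ_s (−1)^{#s} (∏_{i<T} Q_i Γ(S_{i−1}) Xf_i Γ(S_i⁻¹))_{ss} = Σ_s (−1)^{#s} (∏_{i<T} Γ(S_{i−1}⁻¹) Q_i Γ(S_{i−1}) Xf_i)_{ss}`:
consecutive `Γ(S_i⁻¹) · Q_{i+1} · Γ(S_i)` regroup into the conjugated insertion and the seam factor
`Γ(S_{T−1}⁻¹)` moves from the far right to the far left by cyclicity of the supertrace (the fermion
parity commutes with every `Γ`; no parity assumption on `Q`, `Xf`).  The statement is the registered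
stub signature verbatim (`NeZero T` is not needed). [cite: Luscher1977, pp. 283–292] -/
theorem stub_supertrace_undress_insert :
    ∀ (ι : Type) [LinearOrder ι] [Fintype ι] (T : ℕ) [NeZero T] (S : ZMod T → Matrix ι ι ℂ)
      (Q Xf : ZMod T → Matrix (Finset ι) (Finset ι) ℂ), (∀ t, IsUnit (S t).det) →
      ∑ s : Finset ι, (-1 : ℂ) ^ s.card *
          (((List.range T).map fun i : ℕ =>
            Q (i : ZMod T) * fockLift (S ((i : ZMod T) - 1)) * Xf (i : ZMod T) * fockLift ((S (i : ZMod T))⁻¹)).prod) s s =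
        ∑ s : Finset ι, (-1 : ℂ) ^ s.card *
          (((List.range T).map fun i : ℕ =>
            fockLift ((S ((i : ZMod T) - 1))⁻¹) * Q (i : ZMod T) * fockLift (S ((i : ZMod T) - 1)) *
              Xf (i : ZMod T)).prod) s s := by
  intro _ _ _ T _ S Q Xf hS
  exact StubSupertraceUndressInsert.supertrace_undress_insert T S Q Xf hS

end Summit.QuantumFields.QCD.Cruxes.RobustYangMillsHandover.PinTheInfimum
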